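import Summits.Ventures.PercRepro.S1TriangleSevenC

/-!
# PercRepro — `P(7) = 11`, PART 3: the three triangles through the eighth point `v` (p2, gen 17)

The sub-case `|H| = 8` of CASE B (SUBCLAIM-S1 v31 §6.3 (xv)): the hyperplane `H = cl(C)` is the cone `C` plus one
point `v`, and the three triangles through `v` avoid `x` and cover `C ∖ {x}`. The two of them through the points
`a₁, b₁` of `L₁ ∖ {x}` are distinct and their third points `p, q` avoid `L₁`; if `p, q` lie on one line, the third
triangle through `v` carries the two points of the remaining line (a `4`-point line); otherwise the closure of
`{v, a₁, b₁}` — of rank `≤ 3` — contains `L₁`, both triangles, hence the line of `p` and the point `q`: `7` points.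

* **`no_three_triangles_through_v`** — the contradiction, from the covering and containment hypotheses.
Axioms: standard.
-/

open scoped Matroid

namespace PercRepro

namespace S1

open Set

variable {α : Type}

/-- **The three triangles through `v` cannot cover the cone** — the sub-case `|H| = 8` of CASE B. -/
theorem no_three_triangles_through_v (M : Matroid α) [M.Finite]
    (hC1 : ∀ L ⊆ M.E, M.eRk L = 2 → L.ncard ≤ 3) (hC2 : ∀ P ⊆ M.E, M.eRk P ≤ 3 → P.ncard ≤ 6)
    {x : α} (hx : M.IsNonloop x)
    {L₁ L₂ L₃ : Set α} (h1 : L₁ ∈ ThmN.trianglesThrough M x) (h2 : L₂ ∈ ThmN.trianglesThrough M x)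
    (h3 : L₃ ∈ ThmN.trianglesThrough M x) (h12 : L₁ ≠ L₂) (h13 : L₁ ≠ L₃) (h23 : L₂ ≠ L₃)
    (hthree' : ∀ L ∈ ThmN.trianglesThrough M x, L = L₁ ∨ L = L₂ ∨ L = L₃)
    {v : α} (hvE : v ∈ M.E) (hvC : v ∉ L₁ ∪ L₂ ∪ L₃) (hv3 : (ThmN.trianglesThrough M v).ncard = 3)
    (hpick : ∀ z ∈ L₁ ∪ L₂ ∪ L₃, z ≠ x → ∃ T ∈ ThmN.trianglesThrough M v, z ∈ T)
    (hTin : ∀ T ∈ ThmN.trianglesThrough M v, ∀ z ∈ T, z ≠ v → z ∈ L₁ ∪ L₂ ∪ L₃ ∧ z ≠ x) : False := by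
  classical
  have hTfin : ∀ z, (ThmN.trianglesThrough M z).Finite :=
  fun z => M.ground_finite.finite_subsets.subset (fun C hC => hC.1.subset_ground)
  have hI12 : L₁ ∩ L₂ = {x} := ThmN.inter_eq_singleton_of_mem_trianglesThrough M hC1 h1 h2 h12
  have hI13 : L₁ ∩ L₃ = {x} := ThmN.inter_eq_singleton_of_mem_trianglesThrough M hC1 h1 h3 h13
  have hI23 : L₂ ∩ L₃ = {x} := ThmN.inter_eq_singleton_of_mem_trianglesThrough M hC1 h2 h3 h23
  have hmeetx : ∀ {Li Lj : Set α}, Li ∩ Lj = {x} → ∀ z, z ∈ Li → z ∈ Lj → z ≠ x → False := by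
    intro Li Lj hI z hzi hzj hzx
    have : z ∈ Li ∩ Lj := ⟨hzi, hzj⟩
    rw [hI, Set.mem_singleton_iff] at this
    exact hzx this
  -- the two further points of `L₁`
  have hL1' : (L₁ \ {x}).ncard = 2 := by rw [Set.ncard_sdiff_singleton_of_mem h1.2.2, h1.2.1]
  obtain ⟨a₁, b₁, hab₁, hL₁ab⟩ := Set.ncard_eq_two.1 hL1'
  have ha₁ : a₁ ∈ L₁ \ {x} := by rw [hL₁ab]; simp
  have hb₁ : b₁ ∈ L₁ \ {x} := by rw [hL₁ab]; simp
  have ha₁x : a₁ ≠ x := fun h => ha₁.2 (Set.mem_singleton_iff.2 h)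
  have hb₁x : b₁ ≠ x := fun h => hb₁.2 (Set.mem_singleton_iff.2 h)
  have hL₁T : L₁ ∈ ThmN.triangles M := ⟨h1.1, h1.2.1⟩
  have hL₂T : L₂ ∈ ThmN.triangles M := ⟨h2.1, h2.2.1⟩
  have hL₃T : L₃ ∈ ThmN.triangles M := ⟨h3.1, h3.2.1⟩
  have hvL : ∀ {L : Set α}, L ⊆ L₁ ∪ L₂ ∪ L₃ → v ∉ L := fun hL hvL' => hvC (hL hvL')
  -- a triangle through `v` containing two points of one line is impossible
  have hvline : ∀ T ∈ ThmN.trianglesThrough M v, ∀ L ∈ ThmN.triangles M, L ⊆ L₁ ∪ L₂ ∪ L₃ →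
      ∀ a ∈ L, ∀ b ∈ L, a ≠ b → a ∈ T → b ∈ T → False := by
    intro T hT L hL hLC a haL b hbL hab haT hbT
    have hne : T ≠ L := fun h => hvL hLC (h ▸ hT.2.2)
    exact two_triangles_share_pair M hC1 ⟨hT.1, hT.2.1⟩ hL hne haT haL hbT hbL hab
  -- `T_a ∋ a₁`, `T_b ∋ b₁`, distinct
  obtain ⟨Ta, hTa, ha₁Ta⟩ := hpick a₁ (Or.inl (Or.inl ha₁.1)) ha₁x
  obtain ⟨Tb, hTb, hb₁Tb⟩ := hpick b₁ (Or.inl (Or.inl hb₁.1)) hb₁x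
  have hTab : Ta ≠ Tb := by
    intro h
    exact hvline Ta hTa L₁ hL₁T (fun z hz => Or.inl (Or.inl hz)) a₁ ha₁.1 b₁ hb₁.1 hab₁ ha₁Ta (h ▸ hb₁Tb)
  have hIab : Ta ∩ Tb = {v} := ThmN.inter_eq_singleton_of_mem_trianglesThrough M hC1 hTa hTb hTab
  -- the third points `p ∈ T_a`, `q ∈ T_b`
  have hva₁ : v ≠ a₁ := fun h => hvC (h ▸ Or.inl (Or.inl ha₁.1))
  have hvb₁ : v ≠ b₁ := fun h => hvC (h ▸ Or.inl (Or.inl hb₁.1))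
  have hp1 : (Ta \ {v, a₁}).ncard = 1 := by
    have hsub : ({v, a₁} : Set α) ⊆ Ta := Set.insert_subset hTa.2.2 (Set.singleton_subset_iff.2 ha₁Ta)
    rw [Set.ncard_sdiff hsub (Set.toFinite _), hTa.2.1, Set.ncard_pair hva₁]
  obtain ⟨p, hp⟩ := Set.ncard_eq_one.1 hp1
  have hpTa : p ∈ Ta := by
    have : p ∈ Ta \ {v, a₁} := by rw [hp]; exact Set.mem_singleton p
    exact this.1
  have hpv : p ≠ v := by
    have : p ∈ Ta \ {v, a₁} := by rw [hp]; exact Set.mem_singleton p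
    exact fun h => this.2 (by rw [h]; simp)
  have hpa₁ : p ≠ a₁ := by
    have : p ∈ Ta \ {v, a₁} := by rw [hp]; exact Set.mem_singleton p
    exact fun h => this.2 (by rw [h]; simp)
  have hTa_eq : ∀ z ∈ Ta, z = v ∨ z = a₁ ∨ z = p := by
    intro z hz
    by_cases hzv : z = v
    · exact Or.inl hzv
    by_cases hza : z = a₁
    · exact Or.inr (Or.inl hza)
    have : z ∈ Ta \ {v, a₁} := ⟨hz, by simp only [Set.mem_insert_iff, Set.mem_singleton_iff]; tauto⟩
    rw [hp, Set.mem_singleton_iff] at this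
    exact Or.inr (Or.inr this)
  have hq1 : (Tb \ {v, b₁}).ncard = 1 := by
    have hsub : ({v, b₁} : Set α) ⊆ Tb := Set.insert_subset hTb.2.2 (Set.singleton_subset_iff.2 hb₁Tb)
    rw [Set.ncard_sdiff hsub (Set.toFinite _), hTb.2.1, Set.ncard_pair hvb₁]
  obtain ⟨q, hq⟩ := Set.ncard_eq_one.1 hq1
  have hqTb : q ∈ Tb := by
    have : q ∈ Tb \ {v, b₁} := by rw [hq]; exact Set.mem_singleton q
    exact this.1
  have hqv : q ≠ v := by
    have : q ∈ Tb \ {v, b₁} := by rw [hq]; exact Set.mem_singleton q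
    exact fun h => this.2 (by rw [h]; simp)
  have hqb₁ : q ≠ b₁ := by
    have : q ∈ Tb \ {v, b₁} := by rw [hq]; exact Set.mem_singleton q
    exact fun h => this.2 (by rw [h]; simp)
  have hTb_eq : ∀ z ∈ Tb, z = v ∨ z = b₁ ∨ z = q := by
    intro z hz
    by_cases hzv : z = v
    · exact Or.inl hzv
    by_cases hzb : z = b₁
    · exact Or.inr (Or.inl hzb)
    have : z ∈ Tb \ {v, b₁} := ⟨hz, by simp only [Set.mem_insert_iff, Set.mem_singleton_iff]; tauto⟩
    rw [hq, Set.mem_singleton_iff] at this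
    exact Or.inr (Or.inr this)
  obtain ⟨hpC, hpx⟩ := hTin Ta hTa p hpTa hpv
  obtain ⟨hqC, hqx⟩ := hTin Tb hTb q hqTb hqv
  -- `p, q ∉ L₁`
  have hpL₁ : p ∉ L₁ := by
    intro hpL
    have : p ∈ L₁ \ {x} := ⟨hpL, fun h => hpx (Set.mem_singleton_iff.1 h)⟩
    rw [hL₁ab] at this
    simp only [Set.mem_insert_iff, Set.mem_singleton_iff] at this
    rcases this with h | h
    · exact hpa₁ h
    · -- `p = b₁ ∈ T_a ∩ T_b = {v}`
      have : b₁ ∈ Ta ∩ Tb := ⟨h ▸ hpTa, hb₁Tb⟩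
      rw [hIab, Set.mem_singleton_iff] at this
      exact hvb₁ this.symm
  have hqL₁ : q ∉ L₁ := by
    intro hqL
    have : q ∈ L₁ \ {x} := ⟨hqL, fun h => hqx (Set.mem_singleton_iff.1 h)⟩
    rw [hL₁ab] at this
    simp only [Set.mem_insert_iff, Set.mem_singleton_iff] at this
    rcases this with h | h
    · have : a₁ ∈ Ta ∩ Tb := ⟨ha₁Ta, h ▸ hqTb⟩
      rw [hIab, Set.mem_singleton_iff] at this
      exact hva₁ this.symm
    · exact hqb₁ h
  have hpq : p ≠ q := by
    intro h
    have : p ∈ Ta ∩ Tb := ⟨hpTa, h ▸ hqTb⟩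
    rw [hIab, Set.mem_singleton_iff] at this
    exact hpv this
  -- the plane argument for `p`, `q` on different lines
  have hQ : ∀ Lj ∈ ThmN.trianglesThrough M x, ∀ Lk ∈ ThmN.trianglesThrough M x, L₁ ≠ Lj → L₁ ≠ Lk → Lj ≠ Lk →
      p ∈ Lj → q ∈ Lk → False := by
    intro Lj hLj Lk hLk h1j h1k hjk hpj hqk
    obtain ⟨hn5, hr5⟩ := two_lines_ncard_eRk M hC1 hx h1 hLj h1j
    have hQE : ({v, a₁, b₁} : Set α) ⊆ M.E :=
      Set.insert_subset hvE (Set.insert_subset (h1.1.subset_ground ha₁.1)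
        (Set.singleton_subset_iff.2 (h1.1.subset_ground hb₁.1)))
    have hrQ : M.eRk (M.closure {v, a₁, b₁}) ≤ 3 := by
      rw [M.eRk_closure_eq]
      calc M.eRk {v, a₁, b₁} ≤ ({v, a₁, b₁} : Set α).encard := M.eRk_le_encard _
        _ ≤ 3 := by
          rw [Set.encard_insert_of_notMem (by simp [hva₁, hvb₁]), Set.encard_pair hab₁]; norm_num
    have hQ6 := hC2 _ (M.closure_subset_ground _) hrQ
    -- `L₁ ⊆ Q`
    have hL₁Q : L₁ ⊆ M.closure {v, a₁, b₁} :=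
      (triangle_subset_closure_pair M hL₁T ha₁.1 hb₁.1 hab₁).trans
        (M.closure_subset_closure (by intro z hz; simp only [Set.mem_insert_iff, Set.mem_singleton_iff] at hz ⊢; tauto))
    have hvQ : v ∈ M.closure {v, a₁, b₁} := M.mem_closure_of_mem (by simp) hQE
    -- `T_a, T_b ⊆ Q`
    have hTaQ : Ta ⊆ M.closure {v, a₁, b₁} :=
      (triangle_subset_closure_pair M ⟨hTa.1, hTa.2.1⟩ hTa.2.2 ha₁Ta hva₁).trans
        (M.closure_subset_closure (by intro z hz; simp only [Set.mem_insert_iff, Set.mem_singleton_iff] at hz ⊢; tauto))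
    have hTbQ : Tb ⊆ M.closure {v, a₁, b₁} :=
      (triangle_subset_closure_pair M ⟨hTb.1, hTb.2.1⟩ hTb.2.2 hb₁Tb hvb₁).trans
        (M.closure_subset_closure (by intro z hz; simp only [Set.mem_insert_iff, Set.mem_singleton_iff] at hz ⊢; tauto))
    have hpQ : p ∈ M.closure {v, a₁, b₁} := hTaQ hpTa
    have hqQ : q ∈ M.closure {v, a₁, b₁} := hTbQ hqTb
    have hxQ : x ∈ M.closure {v, a₁, b₁} := hL₁Q h1.2.2
    -- `Lj ⊆ cl{x, p} ⊆ Q`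
    have hLjQ : Lj ⊆ M.closure {v, a₁, b₁} :=
      (triangle_subset_closure_pair M ⟨hLj.1, hLj.2.1⟩ hLj.2.2 hpj (Ne.symm hpx)).trans
        ((M.closure_subset_closure (Set.insert_subset hxQ (Set.singleton_subset_iff.2 hpQ))).trans
          (by rw [M.closure_closure]))
    -- seven points in `Q`
    have hsub7 : L₁ ∪ Lj ∪ {v, q} ⊆ M.closure {v, a₁, b₁} :=
      Set.union_subset (Set.union_subset hL₁Q hLjQ) (Set.insert_subset hvQ (Set.singleton_subset_iff.2 hqQ))
    have hvnot : v ∉ L₁ ∪ Lj := by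
      rintro (h | h)
      · exact hvC (Or.inl (Or.inl h))
      · rcases hthree' Lj hLj with rfl | rfl | rfl
        · exact hvC (Or.inl (Or.inl h))
        · exact hvC (Or.inl (Or.inr h))
        · exact hvC (Or.inr h)
    have hqnot : q ∉ L₁ ∪ Lj := by
      rintro (h | h)
      · exact hqL₁ h
      · exact hmeetx (ThmN.inter_eq_singleton_of_mem_trianglesThrough M hC1 hLj hLk hjk) q h hqk hqx
    have hLjE : L₁ ∪ Lj ⊆ M.E := Set.union_subset h1.1.subset_ground hLj.1.subset_ground
    have hfin5 : (L₁ ∪ Lj).Finite := M.ground_finite.subset hLjE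
    have hdisj : Disjoint (L₁ ∪ Lj) ({v, q} : Set α) := by
      rw [Set.disjoint_left]
      intro z hz hz'
      simp only [Set.mem_insert_iff, Set.mem_singleton_iff] at hz'
      rcases hz' with rfl | rfl
      · exact hvnot hz
      · exact hqnot hz
    have h7 : (L₁ ∪ Lj ∪ {v, q}).ncard = 7 := by
      rw [Set.ncard_union_eq hdisj hfin5 (Set.toFinite _), hn5, Set.ncard_pair (Ne.symm hqv)]
    have := Set.ncard_le_ncard hsub7 (M.ground_finite.subset (M.closure_subset_ground _))
    omega
  -- the same-line case: the two points of the third line lie on one triangle through `v`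
  have hsameline : ∀ Lj ∈ ThmN.trianglesThrough M x, ∀ Lk ∈ ThmN.trianglesThrough M x,
      L₁ ≠ Lj → L₁ ≠ Lk → Lj ≠ Lk → p ∈ Lj → q ∈ Lj → False := by
    intro Lj hLj Lk hLk h1j h1k hjk hpj hqj
    have hI1k : L₁ ∩ Lk = {x} := ThmN.inter_eq_singleton_of_mem_trianglesThrough M hC1 h1 hLk h1k
    have hIjk : Lj ∩ Lk = {x} := ThmN.inter_eq_singleton_of_mem_trianglesThrough M hC1 hLj hLk hjk
    have hLkC : Lk ⊆ L₁ ∪ L₂ ∪ L₃ := by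
      rcases hthree' Lk hLk with rfl | rfl | rfl
      · exact fun z hz => Or.inl (Or.inl hz)
      · exact fun z hz => Or.inl (Or.inr hz)
      · exact fun z hz => Or.inr hz
    have hLk' : (Lk \ {x}).ncard = 2 := by rw [Set.ncard_sdiff_singleton_of_mem hLk.2.2, hLk.2.1]
    obtain ⟨c, d, hcd, hLkcd⟩ := Set.ncard_eq_two.1 hLk'
    have hc : c ∈ Lk \ {x} := by rw [hLkcd]; simp
    have hd : d ∈ Lk \ {x} := by rw [hLkcd]; simp
    have hcx : c ≠ x := fun h => hc.2 (Set.mem_singleton_iff.2 h)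
    have hdx : d ≠ x := fun h => hd.2 (Set.mem_singleton_iff.2 h)
    obtain ⟨Tc, hTc, hcTc⟩ := hpick c (hLkC hc.1) hcx
    obtain ⟨Td, hTd, hdTd⟩ := hpick d (hLkC hd.1) hdx
    -- a point of `Lk ∖ {x}` is not `v`, `a₁`, `b₁`, `p` or `q`
    have hnot : ∀ z ∈ Lk, z ≠ x → z ≠ v ∧ z ≠ a₁ ∧ z ≠ b₁ ∧ z ≠ p ∧ z ≠ q := by
      intro z hz hzx
      refine ⟨fun h => hvC (h ▸ hLkC hz), fun h => hmeetx hI1k z (h ▸ ha₁.1) hz hzx,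
        fun h => hmeetx hI1k z (h ▸ hb₁.1) hz hzx, fun h => hmeetx hIjk z (h ▸ hpj) hz hzx,
        fun h => hmeetx hIjk z (h ▸ hqj) hz hzx⟩
    have hTcTa : Tc ≠ Ta := by
      intro h
      obtain ⟨h1', h2', -, h4', -⟩ := hnot c hc.1 hcx
      rcases hTa_eq c (h ▸ hcTc) with e | e | e
      · exact h1' e
      · exact h2' e
      · exact h4' e
    have hTcTb : Tc ≠ Tb := by
      intro h
      obtain ⟨h1', -, h3', -, h5'⟩ := hnot c hc.1 hcx
      rcases hTb_eq c (h ▸ hcTc) with e | e | e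
      · exact h1' e
      · exact h3' e
      · exact h5' e
    have hTdTa : Td ≠ Ta := by
      intro h
      obtain ⟨h1', h2', -, h4', -⟩ := hnot d hd.1 hdx
      rcases hTa_eq d (h ▸ hdTd) with e | e | e
      · exact h1' e
      · exact h2' e
      · exact h4' e
    have hTdTb : Td ≠ Tb := by
      intro h
      obtain ⟨h1', -, h3', -, h5'⟩ := hnot d hd.1 hdx
      rcases hTb_eq d (h ▸ hdTd) with e | e | e
      · exact h1' e
      · exact h3' e
      · exact h5' e
    have hTcTd : Tc = Td := by
      by_contra hne
      exact not_four_distinct_of_ncard_three hv3 (hTfin v) hTa hTb hTc hTd hTab (Ne.symm hTcTa)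
        (Ne.symm hTdTa) (Ne.symm hTcTb) (Ne.symm hTdTb) hne
    exact hvline Tc hTc Lk ⟨hLk.1, hLk.2.1⟩ hLkC c hc.1 d hd.1 hcd hcTc (hTcTd ▸ hdTd)
  -- the dispatch
  have hpC' : p ∈ L₂ ∨ p ∈ L₃ := by
    rcases hpC with (h | h) | h
    · exact absurd h hpL₁
    · exact Or.inl h
    · exact Or.inr h
  have hqC' : q ∈ L₂ ∨ q ∈ L₃ := by
    rcases hqC with (h | h) | h
    · exact absurd h hqL₁
    · exact Or.inl h
    · exact Or.inr h
  rcases hpC' with hp2 | hp3 <;> rcases hqC' with hq2 | hq3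
  · exact hsameline L₂ h2 L₃ h3 h12 h13 h23 hp2 hq2
  · exact hQ L₂ h2 L₃ h3 h12 h13 h23 hp2 hq3
  · exact hQ L₃ h3 L₂ h2 h13 h12 (Ne.symm h23) hp3 hq2
  · exact hsameline L₃ h3 L₂ h2 h13 h12 (Ne.symm h23) hp3 hq3


end S1

end PercRepro
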